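import Literature.Geometry.Riemannian.MetricFlowFLimitAdmissibleAux
import HarnessLib

/-!
# Convergence within the extended correspondence (Bamler 2023, §5.4, Lemma 5.20, (5.28))

R. Bamler, *Compactness theory of the space of super Ricci flows*, Invent. Math. 233 (2023), §5.4,
Lemma 5.20 (arXiv v1 Lemma 121): *"… there is a metric flow pair `(𝒳^∞, (μ^∞_t)_{t ∈ I'^{,∞}})`
over `I` … and a family of isometric embeddings `(φ^∞_t : 𝒳^∞_t → Z_t)_{t ∈ I''^{,∞}}` such that
`ℭ' := ((Z_t, d^Z_t)_{t ∈ I}, (φⁱ_t)_{t ∈ I''^{,i}, i ∈ ℕ ∪ {∞}})` is a correspondence between all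
metric flows `𝒳ⁱ`, `i ∈ ℕ ∪ {∞}`, and such that we have convergence (5.28)
`d_𝔽^{ℭ',J}((𝒳ⁱ, (μⁱ_t)), (𝒳^∞, (μ^∞_t))) → 0`."* End of the proof ("It remains to show (5.28)"):
with couplings `q^{i,∞}_t` of `μⁱ_t, μ^∞_t` such that `∫ d^Z_t(φⁱ_t(xⁱ), φ^∞_t(x^∞)) dq^{i,∞}_t ≤
2^{-i+1}`, the estimates (5.29)–(5.31) give, for `s ≤ t` in `I ∖ Eⁱ`, compact `Y ⊆ 𝒳^∞_t`,
`ε > 0` and large `j`, *"`∫_{𝒳ⁱ_t × Y} d_{W₁}^{Z_s}((φⁱ_s)_* νⁱ_{xⁱ;s}, (φ^∞_s)_* ν^∞_{x^∞;s})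
dq^{i,∞}_t ≤ 2^{-i+3} + ∫_{𝒳ʲ_t × Y} d^Z_t(φʲ_t(xʲ), φ^∞_t(x^∞)) dq^{j,∞}_t + ε`. So letting
`j → ∞` and then `ε → 0` and finally `Y → 𝒳^∞_t` yields
`∫_{𝒳ⁱ_t × 𝒳^∞_t} d_{W₁}^{Z_s}((φⁱ_s)_* νⁱ_{xⁱ;s}, (φ^∞_s)_* ν^∞_{x^∞;s}) dq^{i,∞}_t ≤ 2^{-i+3}`.
This concludes the proof of (5.28)."*

This file proves this last step in the tree's vocabulary, as the admissibility
(`MetricFlowPair.FDistAdmissibleWith`, `MetricFlowFConvergenceTimewise.lean`) of the radius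
`c 0 + 2 d` with the exceptional set `E` for `d_𝔽^{ℭ'.pair i ∞, J}(P i, P∞)`, where, along the tail
`P (i + k)` of the sequence: `d` bounds `d_𝔽^{ℭ', I₀ ∖ E}(P i, P (i + k))` (in the source
`2^{-i+2}`), `c k → 0` bounds `d_{W₁}^{Z_t}((φ^{i+k}_t)_* μ^{i+k}_t, (φ^∞_t)_* μ^∞_t)` on `I₀ ∖ E`
(in the source `2^{-(i+k)}`), `|E| ≤ (c 0 + 2 d)²`, every point of `𝒳^∞_t` is a limit of points
`φ^{i+k}_t(x_k)` (`𝒳^∞_t = supp μ^∞_t`), and the pushed conjugate heat kernels converge along every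
such sequence (Claim 5.21):

* `MetricFlowPair.exists_isCoupling_lintegral_edist_lt_of_wassersteinW1_map_lt` — the choice of
  `q^{i,∞}_t`;
* `lintegral_le_of_forall_isCompact_setLIntegral_le` — "finally `Y → 𝒳^∞_t`";
* `MetricFlowPair.fDistAdmissibleWith_limit` — **Lemma 5.20, convergence within `ℭ'`**, from
  (5.29)–(5.31) (`MetricFlowFLimitAdmissibleAux.lean`).

## References

* R. H. Bamler, *Compactness theory of the space of super Ricci flows*, Invent. Math. 233 (2023),
  1121–1277 (arXiv:2008.09298), §5.4, Lemma 5.20 (arXiv v1 Lemma 121), (5.28)–(5.31).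
  [Bamler2023]
-/

noncomputable section

open Set MeasureTheory Filter TopologicalSpace Function
open scoped Topology ENNReal NNReal

namespace Literature.Geometry.Riemannian

universe u

/-! ### Couplings with small displacement from a `W₁`-bound of the push-forwards -/

namespace MetricFlowPair

open MetricFlow

variable {I₁ I₂ : Set ℝ} {P₁ : MetricFlowPair.{u} I₁} {P₂ : MetricFlowPair.{u} I₂} {I'' : Set ℝ}

/-- **A `W₁`-bound between the pushed measures within a correspondence is witnessed by a coupling
with small displacement** (the choice of `q^{i,∞}_t` in Bamler 2023, §5.4, proof of Lemma 5.20: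
"choose … a coupling `q^{i,∞}_t` between `μⁱ_t, μ^∞_t` with the property that
`∫ d^Z_t(φⁱ_t(xⁱ), φ^∞_t(x^∞)) dq^{i,∞}_t ≤ 2^{-i+1}`", given
`d^{Z_t}_{W₁}((φⁱ_t)_* μⁱ_t, (φ^∞_t)_* μ^∞_t) ≤ 2^{-i}`): if
`d^{Z_t}_{W₁}((φ¹_t)_* μ¹_t, (φ²_t)_* μ²_t) < a`, then some coupling `q` of `μ¹_t, μ²_t` has
`∫ d^Z_t(φ¹_t x¹, φ²_t x²) dq(x¹, x²) < a`: a coupling in `Z_t × Z_t` of cost `< a` (the infimum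
defining `d_{W₁}`) is carried by `φ¹_t(𝒳¹_t) × φ²_t(𝒳²_t)` (isometric images of complete spaces) and
pulls back along the measurable embedding `φ¹_t × φ²_t` (`IsCoupling.comap_prodMap`).
[cite: Bamler2023, §5.4, Lemma 5.20 (arXiv v1 Lemma 121), proof; §2.1 (Wasserstein distance)] -/
theorem exists_isCoupling_lintegral_edist_lt_of_wassersteinW1_map_lt
    (ℭ : Correspondence₂ P₁.flow P₂.flow I'') {t : ℝ} (ht₁ : t ∈ ℭ.dom₁) (ht₂ : t ∈ ℭ.dom₂)
    {a : ℝ≥0∞}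
    (h : wassersteinW1 (X := ℭ.Z ⟨t, (ℭ.dom₁_subset ht₁).2⟩)
      ((P₁.μ ⟨t, (ℭ.dom₁_subset ht₁).1⟩).map (ℭ.φ₁ t ht₁))
      ((P₂.μ ⟨t, (ℭ.dom₂_subset ht₂).1⟩).map (ℭ.φ₂ t ht₂)) < a) :
    ∃ q : Measure (P₁.flow.Slice ⟨t, (ℭ.dom₁_subset ht₁).1⟩ ×
        P₂.flow.Slice ⟨t, (ℭ.dom₂_subset ht₂).1⟩),
      IsCoupling (P₁.μ ⟨t, (ℭ.dom₁_subset ht₁).1⟩) (P₂.μ ⟨t, (ℭ.dom₂_subset ht₂).1⟩) q ∧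
        ∫⁻ p, edist (ℭ.φ₁ t ht₁ p.1) (ℭ.φ₂ t ht₂ p.2) ∂q < a := by
  haveI := P₁.isProbabilityMeasure_μ ⟨t, (ℭ.dom₁_subset ht₁).1⟩
  haveI := P₂.isProbabilityMeasure_μ ⟨t, (ℭ.dom₂_subset ht₂).1⟩
  have hme₁ : MeasurableEmbedding (ℭ.φ₁ t ht₁) :=
    (ℭ.isometry₁ t ht₁).isClosedEmbedding.measurableEmbedding
  have hme₂ : MeasurableEmbedding (ℭ.φ₂ t ht₂) :=
    (ℭ.isometry₂ t ht₂).isClosedEmbedding.measurableEmbedding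
  simp only [wassersteinW1, iInf_lt_iff] at h
  obtain ⟨⟨γ, hγ⟩, hlt⟩ := h
  obtain ⟨hq, hmap⟩ := hγ.comap_prodMap hme₁ hme₂
  refine ⟨γ.comap (Prod.map (ℭ.φ₁ t ht₁) (ℭ.φ₂ t ht₂)), hq, ?_⟩
  have e := (hme₁.prodMap hme₂).lintegral_map
    (μ := γ.comap (Prod.map (ℭ.φ₁ t ht₁) (ℭ.φ₂ t ht₂))) (fun z ↦ edist z.1 z.2)
  rw [hmap] at e
  calc ∫⁻ p, edist (ℭ.φ₁ t ht₁ p.1) (ℭ.φ₂ t ht₂ p.2) ∂(γ.comap (Prod.map (ℭ.φ₁ t ht₁) (ℭ.φ₂ t ht₂)))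
      = ∫⁻ z, edist z.1 z.2 ∂γ := e.symm
    _ < a := hlt

end MetricFlowPair

/-! ### Letting `Y ↑ 𝒳^∞_t` through compact sets -/

/-- **Exhaustion by compact sets in the second factor** ("finally `Y → 𝒳^∞_t`" in Bamler 2023,
proof of Lemma 5.20): for a finite measure `q` on `X × Y` whose second marginal is inner regular
with respect to compact sets (e.g. any finite Borel measure on a Polish `Y`) and `f ≥ 0`, if
`∫_{X × K} f dq ≤ C` for every compact `K ⊆ Y` then `∫ f dq ≤ C`: compact `K_n` with
`q(X × K_nᶜ) < 1/n` give an increasing sequence of compact sets `K_1 ∪ … ∪ K_n` exhausting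
`q`-almost all of `X × Y`, and monotone convergence (`setLIntegral_iUnion_of_directed`).
[folklore] -/
theorem lintegral_le_of_forall_isCompact_setLIntegral_le {X Y : Type*} [MeasurableSpace X]
    [TopologicalSpace Y] [T2Space Y] [MeasurableSpace Y] [OpensMeasurableSpace Y]
    {q : Measure (X × Y)} [IsFiniteMeasure q] [q.snd.InnerRegularCompactLTTop]
    {f : X × Y → ℝ≥0∞} {C : ℝ≥0∞}
    (h : ∀ K, IsCompact K → ∫⁻ p in Prod.snd ⁻¹' K, f p ∂q ≤ C) : ∫⁻ p, f p ∂q ≤ C := by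
  -- compact `K n` with `q.snd (K n)ᶜ < 1 / n`
  have hK : ∀ n : ℕ, ∃ K : Set Y, IsCompact K ∧ q.snd Kᶜ < (n : ℝ≥0∞)⁻¹ := fun n ↦ by
    obtain ⟨K, -, hKc, hlt⟩ := MeasurableSet.univ.exists_isCompact_sdiff_lt
      (measure_ne_top q.snd _) (ENNReal.inv_ne_zero.2 (ENNReal.natCast_ne_top n))
    exact ⟨K, hKc, by rwa [← compl_eq_univ_sdiff] at hlt⟩
  choose K hKc hKlt using hK
  have hKm : ∀ n, MeasurableSet (K n) := fun n ↦ (hKc n).measurableSet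
  have hSm : MeasurableSet (⋃ n, K n) := MeasurableSet.iUnion hKm
  -- `⋃ K n` has full `q.snd`-measure
  have hS0 : q.snd (⋃ n, K n)ᶜ = 0 := by
    refine le_antisymm (ge_of_tendsto' ENNReal.tendsto_inv_nat_nhds_zero fun n ↦ ?_) bot_le
    exact (measure_mono (compl_subset_compl.2 (subset_iUnion K n))).trans (hKlt n).le
  have hae : ∀ᵐ p ∂q, p ∈ Prod.snd ⁻¹' ⋃ n, K n := by
    rw [ae_iff]
    have h0 : q (Prod.snd ⁻¹' (⋃ n, K n)ᶜ) = 0 := by rw [← Measure.snd_apply hSm.compl]; exact hS0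
    exact h0
  have hmono : Monotone fun n ↦ (Prod.snd ⁻¹' Set.accumulate K n : Set (X × Y)) :=
    fun m n hmn ↦ preimage_mono (Set.monotone_accumulate hmn)
  calc ∫⁻ p, f p ∂q = ∫⁻ p in Prod.snd ⁻¹' ⋃ n, K n, f p ∂q := by
        rw [Measure.restrict_eq_self_of_ae_mem hae]
    _ = ∫⁻ p in ⋃ n, Prod.snd ⁻¹' Set.accumulate K n, f p ∂q := by
        rw [← preimage_iUnion, Set.iUnion_accumulate]
    _ = ⨆ n, ∫⁻ p in Prod.snd ⁻¹' Set.accumulate K n, f p ∂q :=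
        setLIntegral_iUnion_of_directed f hmono.directed_le
    _ ≤ C := iSup_le fun n ↦ h _ (isCompact_accumulate hKc n)

namespace MetricFlowPair

open MetricFlow

/-! ### Lemma 5.20: convergence within the extended correspondence -/

/-- **Bamler 2023, Lemma 5.20 (arXiv v1 Lemma 121), convergence within the extended
correspondence `ℭ'` (5.28), quantitative form.** Let `P n → P∞` be `H`-concentrated metric flow
pairs in a correspondence `ℭ'` indexed by `Option ℕ` (`some n ↦ P n`, `none ↦ P∞`), `E ⊆ I₀`
measurable with `J ⊆ I₀ ∖ E` contained in the domains of `P (i + k)` (all `k`) and of `P∞`. Assume: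
`d_𝔽^{ℭ', I₀ ∖ E}(P i, P (i + k)) ≤ d`;
`d^{Z_t}_{W₁}((φ^{i+k}_t)_* μ^{i+k}_t, (φ^∞_t)_* μ^∞_t) < c k` for `t ∈ I₀ ∖ E`, with
`0 < c k → 0`; `|E| ≤ (c 0 + 2d)²`; every `z ∈ 𝒳^∞_t` is a limit
`φ^{i+k}_t(x_k) → φ^∞_t(z)`; and along every such sequence the pushed kernels converge,
`d^{Z_s}_{W₁}((φ^{i+k}_s)_* ν^{i+k}_{x_k;s}, (φ^∞_s)_* ν^∞_{z;s}) → 0` (`s ≤ t` in `I₀ ∖ E`). Then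
`c 0 + 2d` is admissible for `d_𝔽^{ℭ'.pair i ∞, J}(P i, P∞)` with exceptional set `E`. Proof as
printed: couplings `q^k_t` of `μ^{i+k}_t, μ^∞_t` with `∫ d^Z_t(φ^{i+k}_t x, φ^∞_t z) dq^k_t ≤ c k`
(`exists_isCoupling_lintegral_edist_lt_of_wassersteinW1_map_lt`), `q^0_t` being the couplings of
the conclusion; for `s ≤ t` in `I₀ ∖ E`, compact `Y ⊆ 𝒳^∞_t` and `η > 0`, (5.29)–(5.30)
(`setLIntegral_kernelDistWithin_le_of_pair`) and (5.31) (`exists_forall_ge_kernel_le_edist_add`)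
give `∫_{𝒳ⁱ_t × Y} d_{W₁}(…ⁱ, …^∞) dq^0_t ≤ c 0 + c k + 2d + (c k + η)` for large `k`; let `k → ∞`,
`η → 0` and `Y ↑ 𝒳^∞_t` (`lintegral_le_of_forall_isCompact_setLIntegral_le`).
[cite: Bamler2023, §5.4, Lemma 5.20 (arXiv v1 Lemma 121), (5.28)–(5.31)] -/
theorem fDistAdmissibleWith_limit {I₀ : Set ℝ} {H : ℝ}
    (P : ℕ → MetricFlowPair.{u} I₀) (Pinf : MetricFlowPair.{u} I₀)
    (hP : ∀ n, (P n).flow.IsHConcentrated H) (hPinf : Pinf.flow.IsHConcentrated H)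
    (ℭ' : FamilyCorrespondence (fun o : Option ℕ ↦ (o.elim Pinf P).flow) I₀)
    {i : ℕ} {E J : Set ℝ} (hEm : MeasurableSet E) (hEI : E ⊆ I₀) (hJ : J ⊆ I₀ \ E)
    (hdom : ∀ k, I₀ \ E ⊆ ℭ'.dom (some (i + k))) (hdominf : I₀ \ E ⊆ ℭ'.dom none)
    {d : ℝ} (hd : 0 ≤ d)
    (hclose : ∀ k, fDistWithin (P i) (P (i + k)) (ℭ'.pair (some i) (some (i + k))) (I₀ \ E) ≤
      ENNReal.ofReal d)
    {c : ℕ → ℝ} (hc0 : ∀ k, 0 < c k) (hc : Tendsto c atTop (𝓝 0))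
    (hvol : volume E ≤ ENNReal.ofReal ((c 0 + 2 * d) ^ 2))
    (hW1 : ∀ k t (ht : t ∈ I₀ \ E),
      wassersteinW1 (X := ℭ'.Z ⟨t, (ℭ'.dom_subset none (hdominf ht)).2⟩)
        (((P (i + k)).μ ⟨t, (ℭ'.dom_subset (some (i + k)) (hdom k ht)).1⟩).map
          (ℭ'.φ (some (i + k)) t (hdom k ht)))
        ((Pinf.μ ⟨t, (ℭ'.dom_subset none (hdominf ht)).1⟩).map (ℭ'.φ none t (hdominf ht))) <
        ENNReal.ofReal (c k))
    (happrox : ∀ t (ht : t ∈ I₀ \ E) (z : Pinf.flow.Slice ⟨t, (ℭ'.dom_subset none (hdominf ht)).1⟩),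
      ∃ x : ∀ k, (P (i + k)).flow.Slice ⟨t, (ℭ'.dom_subset (some (i + k)) (hdom k ht)).1⟩,
        Tendsto (fun k ↦ ℭ'.φ (some (i + k)) t (hdom k ht) (x k)) atTop
          (𝓝 (ℭ'.φ none t (hdominf ht) z)))
    (hconv : ∀ s (hs : s ∈ I₀ \ E) t (ht : t ∈ I₀ \ E), s ≤ t →
      ∀ (z : Pinf.flow.Slice ⟨t, (ℭ'.dom_subset none (hdominf ht)).1⟩)
        (x : ∀ k, (P (i + k)).flow.Slice ⟨t, (ℭ'.dom_subset (some (i + k)) (hdom k ht)).1⟩),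
        Tendsto (fun k ↦ ℭ'.φ (some (i + k)) t (hdom k ht) (x k)) atTop
          (𝓝 (ℭ'.φ none t (hdominf ht) z)) →
        Tendsto (fun k ↦ wassersteinW1 (X := ℭ'.Z ⟨s, (ℭ'.dom_subset none (hdominf hs)).2⟩)
          (((P (i + k)).flow.condKernel (x k)
              ⟨s, (ℭ'.dom_subset (some (i + k)) (hdom k hs)).1⟩).map
            (ℭ'.φ (some (i + k)) s (hdom k hs)))
          ((Pinf.flow.condKernel z ⟨s, (ℭ'.dom_subset none (hdominf hs)).1⟩).map
            (ℭ'.φ none s (hdominf hs)))) atTop (𝓝 0)) :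
    FDistAdmissibleWith (P i) Pinf (ℭ'.pair (some i) none) E J (c 0 + 2 * d) := by
  /- Step (0): couplings `q^k_t` of `μ^{i+k}_t, μ^∞_t`, `t ∈ I₀ ∖ E`, with
    `∫ d^Z_t(φ^{i+k}_t x, φ^∞_t z) dq^k_t ≤ c k`; `q^0_t` are the couplings of the conclusion. -/
  have hex : ∀ k t (ht : t ∈ I₀ \ E),
      ∃ q : Measure ((P (i + k)).flow.Slice ⟨t, (ℭ'.dom_subset (some (i + k)) (hdom k ht)).1⟩ ×
        Pinf.flow.Slice ⟨t, (ℭ'.dom_subset none (hdominf ht)).1⟩),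
        IsCoupling ((P (i + k)).μ ⟨t, (ℭ'.dom_subset (some (i + k)) (hdom k ht)).1⟩)
          (Pinf.μ ⟨t, (ℭ'.dom_subset none (hdominf ht)).1⟩) q ∧
        ∫⁻ p, edist (ℭ'.φ (some (i + k)) t (hdom k ht) p.1) (ℭ'.φ none t (hdominf ht) p.2) ∂q ≤
          ENNReal.ofReal (c k) := by
    intro k t ht
    obtain ⟨q, hq, hlt⟩ := exists_isCoupling_lintegral_edist_lt_of_wassersteinW1_map_lt
      (P₁ := P (i + k)) (P₂ := Pinf) (ℭ'.pair (some (i + k)) none) (hdom k ht) (hdominf ht)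
      (hW1 k t ht)
    exact ⟨q, hq, hlt.le⟩
  choose q hq hqD using hex
  have hρ : 0 < c 0 + 2 * d := by linarith [hc0 0]
  refine ⟨hρ, hEm, hEI, hJ, hdom 0, hdominf, hvol, fun t ht ↦ q 0 t ht, fun t ht ↦ hq 0 t ht, ?_⟩
  intro s hs t ht hst
  haveI := (hq 0 t ht).1
  /- Step (4): it suffices to bound the integrals over `𝒳ⁱ_t × Y`, `Y ⊆ 𝒳^∞_t` compact, by
    `c 0 + 2 d + η` for every `η > 0`. -/
  refine lintegral_le_of_forall_isCompact_setLIntegral_le fun Y hY ↦ ?_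
  refine ENNReal.le_of_forall_pos_le_add fun η hη _ ↦ ?_
  -- Step (3): (5.31) on `Y` with `ε = η`
  obtain ⟨k₀, hk₀⟩ := exists_forall_ge_kernel_le_edist_add
    (Xinf := Pinf.flow.Slice ⟨t, (ℭ'.dom_subset none (hdominf ht)).1⟩)
    (X := fun k ↦ (P (i + k)).flow.Slice ⟨t, (ℭ'.dom_subset (some (i + k)) (hdom k ht)).1⟩)
    (φ := fun k ↦ ℭ'.φ (some (i + k)) t (hdom k ht)) (φinf := ℭ'.φ none t (hdominf ht))
    (fun k ↦ ℭ'.isometry (some (i + k)) t (hdom k ht)) (ℭ'.isometry none t (hdominf ht))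
    (fun k y z ↦ kernelDistWithin (P (i + k)) Pinf (ℭ'.pair (some (i + k)) none) (hdom k hs)
      (hdominf hs) (hdom k ht) (hdominf ht) (y, z))
    (fun k y y' z ↦ by
      have h := kernelDistWithin_le_add_edist_add_edist (hP (i + k)) hPinf
        (ℭ'.pair (some (i + k)) none) (hdom k hs) (hdominf hs) (hdom k ht) (hdominf ht) hst
        (y, z) (y', z)
      simp only [edist_self, add_zero] at h
      exact h)
    (fun k y z z' ↦ by
      have h := kernelDistWithin_le_add_edist_add_edist (hP (i + k)) hPinf
        (ℭ'.pair (some (i + k)) none) (hdom k hs) (hdominf hs) (hdom k ht) (hdominf ht) hst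
        (y, z) (y, z')
      simp only [edist_self, add_zero] at h
      exact h)
    (fun z ↦ by
      obtain ⟨x, hx⟩ := happrox t ht z
      exact ⟨x, hx, hconv s hs t ht hst z x hx⟩)
    hY (ENNReal.coe_pos.2 hη)
  -- `c k → 0` in `[0, ∞]`
  have hcT : Tendsto (fun k ↦ ENNReal.ofReal (c k)) atTop (𝓝 0) := by
    simpa only [ENNReal.ofReal_zero] using ENNReal.tendsto_ofReal hc
  -- Steps (1)–(2) and (3) combined: the bound for every `k ≥ k₀`
  have hbound : ∀ k ≥ k₀,
      ∫⁻ p in Prod.snd ⁻¹' Y, kernelDistWithin (P i) Pinf (ℭ'.pair (some i) none) (hdom 0 hs)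
          (hdominf hs) (hdom 0 ht) (hdominf ht) p ∂(q 0 t ht) ≤
        ENNReal.ofReal (c 0) + ENNReal.ofReal (c k) + 2 * ENNReal.ofReal d +
          (ENNReal.ofReal (c k) + η) := by
    intro k hk
    haveI := (hq k t ht).1
    -- (5.29)–(5.30) within `ℭ'` for the indices `i`, `i + k`, `∞`
    have h530 := setLIntegral_kernelDistWithin_le_of_pair (fun o : Option ℕ ↦ o.elim Pinf P) ℭ'
      (a := some i) (b := some (i + k)) (c := none) (hP i) (hP (i + k)) hPinf (J := I₀ \ E)
      ⟨hdom 0, hdom k⟩ hs ht (hdominf hs) (hdominf ht) hst (hq 0 t ht) (hq k t ht)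
      hY.measurableSet
    -- (5.31) integrated against `q^k_t`
    have h531 : ∫⁻ p in Prod.snd ⁻¹' Y, kernelDistWithin (P (i + k)) Pinf
        (ℭ'.pair (some (i + k)) none) (hdom k hs) (hdominf hs) (hdom k ht) (hdominf ht) p
          ∂(q k t ht) ≤ ENNReal.ofReal (c k) + η :=
      calc _ ≤ ∫⁻ p in Prod.snd ⁻¹' Y, (edist (ℭ'.φ (some (i + k)) t (hdom k ht) p.1)
            (ℭ'.φ none t (hdominf ht) p.2) + η) ∂(q k t ht) :=
            setLIntegral_mono' (measurable_snd hY.measurableSet) fun p hp ↦ hk₀ k hk p.1 p.2 hp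
        _ ≤ ∫⁻ p, (edist (ℭ'.φ (some (i + k)) t (hdom k ht) p.1)
            (ℭ'.φ none t (hdominf ht) p.2) + η) ∂(q k t ht) := setLIntegral_le_lintegral _ _
        _ = ∫⁻ p, edist (ℭ'.φ (some (i + k)) t (hdom k ht) p.1)
            (ℭ'.φ none t (hdominf ht) p.2) ∂(q k t ht) + η := by
            rw [lintegral_add_right _ measurable_const, lintegral_const, measure_univ, mul_one]
        _ ≤ ENNReal.ofReal (c k) + η := add_le_add (hqD k t ht) le_rfl
    exact h530.trans (add_le_add (add_le_add (add_le_add (hqD 0 t ht) (hqD k t ht))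
      (mul_le_mul_right (hclose k) 2)) h531)
  -- let `k → ∞`
  have hlim : Tendsto (fun k ↦ ENNReal.ofReal (c 0) + ENNReal.ofReal (c k) +
      2 * ENNReal.ofReal d + (ENNReal.ofReal (c k) + (η : ℝ≥0∞))) atTop
      (𝓝 (ENNReal.ofReal (c 0) + 0 + 2 * ENNReal.ofReal d + (0 + η))) :=
    ((tendsto_const_nhds.add hcT).add tendsto_const_nhds).add (hcT.add tendsto_const_nhds)
  refine (ge_of_tendsto hlim (eventually_atTop.2 ⟨k₀, hbound⟩)).trans (le_of_eq ?_)
  rw [add_zero, zero_add, ENNReal.ofReal_add (hc0 0).le (by positivity),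
    ENNReal.ofReal_mul zero_le_two, ENNReal.ofReal_ofNat]

end MetricFlowPair

end Literature.Geometry.Riemannian

end
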